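import Summits.NavierStokesRegularity.NavierStokesRegularity.Theorems.ExtremiserTransienceNearExtremalTransienceExtremiserLiouvilleConstantSpeedBlowDownDecay
import Summits.NavierStokesRegularity.NavierStokesRegularity.Theorems.ExtremiserTransienceNearExtremalTransienceExtremiserLiouvilleConstantSpeedBlowDownVorticityTools
import Summits.NavierStokesRegularity.NavierStokesRegularity.Theorems.ExtremiserTransienceNearExtremalTransienceExtremiserLiouvilleConstantSpeedJetBarycentreBumps
import HarnessLib

/-!
# Crux `ExtremiserTransience.NearExtremalTransience` (stmt-NavierStokesRegularity-21883), line `extremiser_liouville`,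
# stub K1b — THE BLOW-DOWN VORTICITY LAW: `ω_R = R²ω(R·) ⇀ curl(Stokeslet of force b)` in `𝒟′`; for the JET, `ω_R → 0`

`--supports stmt-NavierStokesRegularity-21883` (helper).  Author: prover seat `ns-el-k1b` (g6).  Record
`Lines/extremiser_liouville_k1b_jet.md` §6, step (J2), made rigorous WITHOUT a Stokes–Liouville fact: test g3's multiplier
equation with the (non-compactly supported) solenoidal field `Ψ_B = curl N[B] = N[curl B]` (`N = Γ ∗ ·`, `B ∈ C_c^∞` arbitrary),
using (T1) `…ConstantSpeedBlowDownDecay`, (E) `…ConstantSpeedMultiplierExtension`, the potential theory of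
`…NewtonVectorPotential` and `a₁(Ψ_B(R⁻¹·)) = −R⁻¹∫⟪ω, B(R⁻¹x)⟫dx` (`…ConstantSpeedBlowDownVorticityTools`).

* `tendsto_blowDown_vorticity` : for `v` smooth, `‖v‖ ≡ M`, `D¹v, D²v ∈ L²`, ANY finite `μ` with the multiplier identity, and
  EVERY `B ∈ C_c^∞(ℝ³;ℝ³)`:
  **`κ⋆²M²W · R⁻¹∫⟪curl v x, B(R⁻¹x)⟫dx ⟶ ⟪∫Γ(x) curl B(x) dx, b⟫`**, `b = ∫ v dμ`.  Since `R⁻¹∫⟪ω, B(·/R)⟫ = ∫⟪ω_R, B⟫`,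
  `ω_R = R²ω(R·)`, this says: the blow-down vorticity converges in `𝒟′(ℝ³;ℝ³)` to the vorticity of the Stokeslet of force
  `−b/(κ⋆²M²W)` (`⟪N[curl B](0), b⟫ = −(κ⋆²M²W)·∫⟪curl U, B⟫`, `curl U(y) = −b × y/(4πκ⋆²M²W|y|³)`).
* `tendsto_blowDown_vorticity_of_barycentre_eq_zero` : if `b = 0` then **`R⁻¹∫⟪ω, B(R⁻¹x)⟫dx → 0` for every `B ∈ C_c^∞`**.
* `tendsto_blowDown_vorticity_of_jet` : the residue JET in the axial frame (g5's `integral_eq_zero_of_jet`: `b = 0`) has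
  vanishing blow-down vorticity: **every blow-down of a residue jet is irrotational in the limit**.

READING.  With `V_R = R(v − c)(R·)` bounded in `L²_loc` (slab-energy sandwich) and `curl V_R = ω_R ⇀ 0`, `div V_R = 0`, every weak
`L²_loc` limit of `V_R` is curl- and divergence-free with linear `L²` growth on balls, hence (harmonic) zero: (J2) of the record.
Weak vanishing is all that first-order KKT + the jet structure give; the jet survives only through loss of `L²_loc` compactness of
`V_R` (concentration on the axis / escape to the equatorial plane) — the annular Caccioppoli estimate for the rescaled E–L system
remains THE missing piece (record §6).  WHAT THIS IS NOT: K1b is NOT proved; nothing here proves NS regularity. [folklore]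
-/

noncomputable section

open Set Filter Topology MeasureTheory Metric Function
open scoped ENNReal NNReal Topology InnerProductSpace RealInnerProductSpace ContDiff
open Literature.Analysis.FluidPDE Literature.Analysis

namespace Summit.NavierStokesRegularity.NavierStokesRegularity.Theorems

-- the problem directory repeats the summit name (`NavierStokesRegularity/NavierStokesRegularity`)
set_option linter.dupNamespace false

namespace ExtremiserLiouville

open DepletionLadder.KStar DepletionLadder.KStar.HalfSpace
open Summit.NavierStokesRegularity.NavierStokesRegularity.Theorems.RungReynoldsOne.WeightedSlice

variable {v B : E3 → E3} {c : E3}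

/-- `Γ(0 − x) = Γ(x)`. [folklore] -/
theorem newtonKernel_zero_sub (x : E3) : newtonKernel (0 - x) = newtonKernel x := by
  rw [zero_sub, newtonKernel_eq, newtonKernel_eq, norm_neg]

/-- **THE BLOW-DOWN VORTICITY LAW.**  Let `v` be smooth with `‖v‖ ≡ M`, `D¹v, D²v ∈ L²`, `μ` a finite measure with g3's
multiplier identity for smooth compactly supported divergence-free test fields.  Then for every test field `B ∈ C_c^∞(ℝ³;ℝ³)`:
**`κ⋆²M²W · R⁻¹∫⟪curl v x, B(R⁻¹x)⟫dx ⟶ ⟪∫Γ(x)·curl B(x)dx, ∫ v dμ⟫`** as `R → ∞` — the blow-down vorticity `R²ω(R·)` converges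
in the sense of distributions to the vorticity of the Stokeslet of force `b = ∫ v dμ`. [folklore] -/
theorem tendsto_blowDown_vorticity (hv : ContDiff ℝ ∞ v) {M : ℝ} (hM : ∀ x, ‖v x‖ = M)
    (h1 : ∫⁻ x, ‖iteratedFDeriv ℝ 1 v x‖ₑ ^ 2 < ⊤) (h2 : ∫⁻ x, ‖iteratedFDeriv ℝ 2 v x‖ₑ ^ 2 < ⊤)
    (μ : Measure E3) [IsFiniteMeasure μ]
    (hμ : ∀ φ : E3 → E3, ContDiff ℝ ∞ φ → HasCompactSupport φ → VectorCalculus.IsDivFree φ →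
      Jst v * J1 v φ - kStar ^ 2 * M ^ 2 * (Wpa v * A1 v φ + Zen v * C1 v φ) = ∫ x, ⟪v x, φ x⟫_ℝ ∂μ)
    (hB : ContDiff ℝ ∞ B) (hBc : HasCompactSupport B) :
    Tendsto (fun R : ℝ => kStar ^ 2 * M ^ 2 * Wpa v * (R⁻¹ * ∫ x, ⟪curl v x, B (R⁻¹ • x)⟫_ℝ)) atTop
      (𝓝 ⟪∫ x, newtonKernel x • curl B x, ∫ x, v x ∂μ⟫_ℝ) := by
  -- the vector potential `A = N[B]` and the test field `Ψ = curl A`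
  set A : E3 → E3 := fun y => ∫ x, newtonKernel (y - x) • B x with hA
  obtain ⟨C, hC0, hA0, hAk⟩ := vecNewton_decay hB hBc
  have hAs : ContDiff ℝ ∞ A := contDiff_vecNewton hB hBc
  have hΨs : ContDiff ℝ ∞ (curl A) := contDiff_curl (n := ⊤) (by exact_mod_cast hAs)
  have hΨ2 : ContDiff ℝ 2 (curl A) := hΨs.of_le (by norm_cast)
  -- the multiplier identity for every rescaled field
  have hid : ∀ R : ℝ, 1 ≤ R →
      Jst v * J1 v (fun y => curl A (R⁻¹ • y)) -
          kStar ^ 2 * M ^ 2 * (Wpa v * A1 v (fun y => curl A (R⁻¹ • y)) + Zen v * C1 v (fun y => curl A (R⁻¹ • y))) =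
        ∫ x, ⟪v x, curl A (R⁻¹ • x)⟫_ℝ ∂μ := fun R hR =>
    multiplierIdentity_curl_rescale_of_decay hv hM h1 h2 μ hμ hAs hA0 hAk hR
  -- the bounds of (T1)
  set κ : ℝ := ‖curlCLM‖ with hκ
  have hκ0 : 0 ≤ κ := by rw [hκ]; exact norm_nonneg curlCLM
  set E : E3 → ℝ := fun x => ((1 + ‖x‖) ^ 2)⁻¹ with hE
  have hE0 : ∀ x, 0 ≤ E x := fun x => by positivity
  have hE1 : ∀ x, E x ≤ 1 := fun x => by
    rw [hE]; exact inv_le_one_of_one_le₀ (one_le_pow₀ (by linarith [norm_nonneg x]))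
  set C' : ℝ := (1 + κ) ^ 2 * C with hC'
  have hκC : κ * C ≤ C' := by
    rw [hC']; exact mul_le_mul_of_nonneg_right (by nlinarith [sq_nonneg κ]) hC0
  have hκ2C : κ * (κ * C) ≤ C' := by
    rw [hC', ← mul_assoc]; exact mul_le_mul_of_nonneg_right (by nlinarith [sq_nonneg κ]) hC0
  have hΨb : ∀ y, ‖curl A y‖ ≤ C' := fun y => by
    have h := norm_iteratedFDeriv_curl_le hAs 0 y
    rw [norm_iteratedFDeriv_zero] at h
    calc ‖curl A y‖ ≤ κ * ‖iteratedFDeriv ℝ 1 A y‖ := h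
      _ ≤ κ * (C * E y) := mul_le_mul_of_nonneg_left (hAk 1 le_rfl (by norm_num) y) hκ0
      _ ≤ κ * C := mul_le_mul_of_nonneg_left (mul_le_of_le_one_right hC0 (hE1 y)) hκ0
      _ ≤ C' := hκC
  have hDb : ∀ y, ‖fderiv ℝ (curl A) y‖ ≤ C' := fun y => by
    have h := norm_iteratedFDeriv_curl_le hAs 1 y
    rw [← norm_fderiv_eq_norm_iteratedFDeriv_one] at h
    calc ‖fderiv ℝ (curl A) y‖ ≤ κ * ‖iteratedFDeriv ℝ 2 A y‖ := h
      _ ≤ κ * (C * E y) := mul_le_mul_of_nonneg_left (hAk 2 (by norm_num) (by norm_num) y) hκ0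
      _ ≤ κ * C := mul_le_mul_of_nonneg_left (mul_le_of_le_one_right hC0 (hE1 y)) hκ0
      _ ≤ C' := hκC
  have hcurlb : ∀ y, ‖curl (curl A) y‖ ≤ C' := fun y => by
    calc ‖curl (curl A) y‖ ≤ κ * ‖fderiv ℝ (curl A) y‖ := norm_curl_le _ _
      _ ≤ κ * (κ * ‖iteratedFDeriv ℝ 2 A y‖) := by
          refine mul_le_mul_of_nonneg_left ?_ hκ0
          have h := norm_iteratedFDeriv_curl_le hAs 1 y
          rwa [← norm_fderiv_eq_norm_iteratedFDeriv_one] at h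
      _ ≤ κ * (κ * (C * E y)) :=
          mul_le_mul_of_nonneg_left (mul_le_mul_of_nonneg_left (hAk 2 (by norm_num) (by norm_num) y) hκ0) hκ0
      _ ≤ κ * (κ * C) := mul_le_mul_of_nonneg_left (mul_le_mul_of_nonneg_left (mul_le_of_le_one_right hC0 (hE1 y)) hκ0) hκ0
      _ ≤ C' := hκ2C
  have hDcurl_pt : ∀ y, ‖fderiv ℝ (curl (curl A)) y‖ ≤ C' * E y := fun y => by
    have h := norm_iteratedFDeriv_curl_le hΨs 1 y
    rw [← norm_fderiv_eq_norm_iteratedFDeriv_one] at h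
    have h' := norm_iteratedFDeriv_curl_le hAs 2 y
    calc ‖fderiv ℝ (curl (curl A)) y‖ ≤ κ * ‖iteratedFDeriv ℝ 2 (curl A) y‖ := h
      _ ≤ κ * (κ * ‖iteratedFDeriv ℝ 3 A y‖) := mul_le_mul_of_nonneg_left h' hκ0
      _ ≤ κ * (κ * (C * E y)) :=
          mul_le_mul_of_nonneg_left (mul_le_mul_of_nonneg_left (hAk 3 (by norm_num) le_rfl y) hκ0) hκ0
      _ = (κ * (κ * C)) * E y := by ring
      _ ≤ C' * E y := mul_le_mul_of_nonneg_right hκ2C (hE0 y)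
  have hDcurl : Integrable (fun y => ‖fderiv ℝ (curl (curl A)) y‖ ^ 2) volume := by
    have hcont : Continuous fun y => ‖fderiv ℝ (curl (curl A)) y‖ ^ 2 :=
      ((contDiff_curl (n := ⊤) (by exact_mod_cast hΨs)).continuous_fderiv (by simp)).norm.pow 2
    refine Integrable.mono' (integrable_inv_one_add_norm_sq_sq.const_mul (C' ^ 2)) hcont.aestronglyMeasurable
      (Eventually.of_forall fun y => ?_)
    rw [Real.norm_eq_abs, abs_of_nonneg (sq_nonneg _)]
    have h := hDcurl_pt y
    have h0 : 0 ≤ ‖fderiv ℝ (curl (curl A)) y‖ := norm_nonneg _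
    calc ‖fderiv ℝ (curl (curl A)) y‖ ^ 2 ≤ (C' * E y) ^ 2 := pow_le_pow_left₀ h0 h 2
      _ = C' ^ 2 * (((1 + ‖y‖) ^ 2)⁻¹) ^ 2 := by rw [hE]; ring
  -- (T1)
  have L1 := tendsto_blowDown_pairing_of_sqIntegrable' hv hM h1 h2 μ hΨ2 hΨb hcurlb hDb hDcurl hid
  -- the value at the origin
  have hΨ0 : curl A 0 = ∫ x, newtonKernel x • curl B x := by
    rw [curl_vecNewton hB hBc 0]
    exact integral_congr_ae (Eventually.of_forall fun x => by simp only [newtonKernel_zero_sub])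
  rw [hΨ0] at L1
  -- `a₁(Ψ(R⁻¹·)) = −R⁻¹∫⟪ω, B(R⁻¹·)⟫`
  have IZ : Integrable (fun x => ‖curl v x‖ ^ 2) volume := (integrable_norm_curl_sq (hv.of_le (by norm_cast)) h1).1
  have heq : (fun R : ℝ => kStar ^ 2 * M ^ 2 * Wpa v * (R⁻¹ * ∫ x, ⟪curl v x, B (R⁻¹ • x)⟫_ℝ)) =ᶠ[atTop]
      fun R : ℝ => -(kStar ^ 2 * M ^ 2 * Wpa v * A1 v (fun y => curl A (R⁻¹ • y))) := by
    filter_upwards [eventually_ge_atTop (1 : ℝ)] with R hR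
    rw [A1_vecNewton_rescale (hv.of_le (by norm_cast)) IZ hB hBc hR]
    ring
  refine (L1.neg.congr' heq.symm).congr ?_ |>.mono_right ?_
  · exact fun _ => rfl
  · rw [neg_neg]

/-- **Zero barycentre ⇒ the blow-down vorticity vanishes in `𝒟′`.**  Under the hypotheses of `tendsto_blowDown_vorticity`, if
moreover `M > 0`, `W > 0` and `∫ v dμ = 0`, then `R⁻¹∫⟪curl v x, B(R⁻¹x)⟫dx → 0` for every `B ∈ C_c^∞(ℝ³;ℝ³)`. [folklore] -/
theorem tendsto_blowDown_vorticity_of_barycentre_eq_zero (hv : ContDiff ℝ ∞ v) {M : ℝ} (hM : ∀ x, ‖v x‖ = M)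
    (hMpos : 0 < M) (hW : 0 < Wpa v)
    (h1 : ∫⁻ x, ‖iteratedFDeriv ℝ 1 v x‖ₑ ^ 2 < ⊤) (h2 : ∫⁻ x, ‖iteratedFDeriv ℝ 2 v x‖ₑ ^ 2 < ⊤)
    (μ : Measure E3) [IsFiniteMeasure μ]
    (hμ : ∀ φ : E3 → E3, ContDiff ℝ ∞ φ → HasCompactSupport φ → VectorCalculus.IsDivFree φ →
      Jst v * J1 v φ - kStar ^ 2 * M ^ 2 * (Wpa v * A1 v φ + Zen v * C1 v φ) = ∫ x, ⟪v x, φ x⟫_ℝ ∂μ)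
    (hb : (∫ x, v x ∂μ) = 0) (hB : ContDiff ℝ ∞ B) (hBc : HasCompactSupport B) :
    Tendsto (fun R : ℝ => R⁻¹ * ∫ x, ⟪curl v x, B (R⁻¹ • x)⟫_ℝ) atTop (𝓝 0) := by
  have h := tendsto_blowDown_vorticity hv hM h1 h2 μ hμ hB hBc
  rw [hb, inner_zero_right] at h
  set c₀ : ℝ := kStar ^ 2 * M ^ 2 * Wpa v with hc₀
  have hc₀pos : 0 < c₀ := by have := kStar_pos; positivity
  have h' := h.const_mul c₀⁻¹
  rw [mul_zero] at h'
  refine h'.congr fun R => ?_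
  rw [← mul_assoc, inv_mul_cancel₀ hc₀pos.ne', one_mul]

/-- **JET ⇒ the blow-down vorticity vanishes in `𝒟′`** (axial frame).  For the K1b residue data in the axial frame
(`v` smooth, divergence free, `‖v‖ ≡ M`, `D¹v, D²v ∈ L²`, `M√Z√W > 0`, `μ` finite with the multiplier identity, far field
`c = (0,0,c₂)`, `‖c‖ = M`) in the JET alternative (all slabs square integrable, window energies `≡ E₀` on `[0,1]`), g5's
`integral_eq_zero_of_jet` gives `∫ v dμ = 0`, hence **`R⁻¹∫⟪curl v x, B(R⁻¹x)⟫dx → 0` for every test field `B`**: every blow-down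
of a residue jet is irrotational in the limit (record §6 (J2)). [folklore] -/
theorem tendsto_blowDown_vorticity_of_jet (hv : ContDiff ℝ ∞ v) (hdiv : VectorCalculus.IsDivFree v) {M : ℝ}
    (hM : ∀ x, ‖v x‖ = M) (h1 : ∫⁻ x, ‖iteratedFDeriv ℝ 1 v x‖ₑ ^ 2 < ⊤) (h2 : ∫⁻ x, ‖iteratedFDeriv ℝ 2 v x‖ₑ ^ 2 < ⊤)
    (hpos : 0 < M * Real.sqrt (Zen v) * Real.sqrt (Wpa v))
    (μ : Measure E3) [IsFiniteMeasure μ]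
    (hμ : ∀ ψ : E3 → E3, ContDiff ℝ ∞ ψ → HasCompactSupport ψ → VectorCalculus.IsDivFree ψ →
      Jst v * J1 v ψ - kStar ^ 2 * M ^ 2 * (Wpa v * A1 v ψ + Zen v * C1 v ψ) = ∫ x, ⟪v x, ψ x⟫_ℝ ∂μ)
    (hc0 : c 0 = 0) (hc1 : c 1 = 0) (hc2 : c 2 ≠ 0) (hcM : ‖c‖ = M)
    (hL2 : ∀ T : ℝ, Integrable (fun x => {x : E3 | |x 2| ≤ T}.indicator (fun x => ‖v x - c‖ ^ 2) x) volume)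
    {E₀ : ℝ} (hE : ∀ u ∈ Icc (0 : ℝ) 1, (∫ x : E3, deriv Real.smoothTransition (x 2 - u) * ‖v x - c‖ ^ 2) = E₀)
    (hB : ContDiff ℝ ∞ B) (hBc : HasCompactSupport B) :
    Tendsto (fun R : ℝ => R⁻¹ * ∫ x, ⟪curl v x, B (R⁻¹ • x)⟫_ℝ) atTop (𝓝 0) := by
  have hM0 : 0 ≤ M := (norm_nonneg _).trans (hM 0).le
  have hMpos : 0 < M := by
    rcases hM0.lt_or_eq with h | h
    · exact h
    · rw [← h, zero_mul, zero_mul] at hpos; exact absurd hpos (lt_irrefl 0)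
  have hW : 0 < Wpa v := by
    have hs : 0 < Real.sqrt (Wpa v) := by
      by_contra h
      have h0 : Real.sqrt (Wpa v) = 0 := le_antisymm (not_lt.1 h) (Real.sqrt_nonneg _)
      rw [h0, mul_zero] at hpos; exact lt_irrefl 0 hpos
    exact Real.sqrt_pos.1 hs
  have hb := integral_eq_zero_of_jet hv hdiv hM h1 h2 μ hμ hc0 hc1 hc2 hcM hL2 hE
  exact tendsto_blowDown_vorticity_of_barycentre_eq_zero hv hM hMpos hW h1 h2 μ hμ hb hB hBc

end ExtremiserLiouville

end Summit.NavierStokesRegularity.NavierStokesRegularity.Theorems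

end
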